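import Summits.BirchSwinnertonDyer.BirchSwinnertonDyer.Theorems.SylvesterTwoHeegnerIndexCMFlipBottomClass
import Literature.NumberTheory.EllipticCurves.HeegnerPointsKolyvaginPrimaryPointsProofs
import Literature.NumberTheory.EllipticCurves.HeegnerPointsKolyvaginEulerSystem
import Literature.NumberTheory.EllipticCurves.KolyvaginChiComponent
import Mathlib.GroupTheory.PGroup
import HarnessLib

/-!
# (G) of leaf (L1), crux `UpperOffV0HSYPlus` (stmt-BirchSwinnertonDyer-19804): THE BOTTOM GLUE —
# the class of the bottom `χ_B`-component `ψ_B(P₁^{χ_B})` IS the Kummer class `δ Y₁` of HSY's point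

Skeleton of record VARIANT M (`Cruxes/UpperOffV0HSYPlus/Lines/coupled_variantM.lean` 406ca288e244d392);
card v28; planner D472/D475.  Sibling of `…CMFlipLevelPrime` (#F1), whose conclusion reads
`c_A(ℓ) Selmer at λ ↔ c(ψ_B (Σᵢ ρ_{tᵢ}(tᵢ • κ⁻¹ ι y₁))) ∈ T_B(λ)`; block 1 of (L1) (#24
`L1_of_cmFrameClasses_four`) wants `… ↔ δ Y₁ ∈ T_B(λ)` for the point `Y₁ ∈ E_p(K)` of #19
`disp₀_of_named` (`ι(Y₁) = ψ_B κ⁻¹ ι_pt(Σ_{h ∈ H} h y₁ − T)`, `3 T = 0`).  This file identifies the two: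

* `bottom_chiComponent_eq_toGeomPoints` (G-a): for the PRODUCT representatives `t (q, h) = T(q̃) T(h)` of
  `Γ_K / Gal(K̄/K[9p])` (`H ≤ Gal(K[9p]/K)` the stabiliser of `∛3, ∛p`, `T` lifts along `emb`),
  `ψ_B (Σᵢ ρ_{tᵢ}(tᵢ • κ⁻¹ ι_pt y₁)) = ι([Gal(K[9p]/K) : H] • Y₁ + T₀)` with `3 T₀ = 0`, `T₀ ∈ E_p(K)`;
* `odd_card_quotient_stabilizer` (G-c): `[Gal(K[9p]/K) : H]` is a power of `3`, hence odd (`μ₃ ⊂ K`);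
* `kolyvaginClass_toGeomPoints_eq_kummerClassOfPoint` / `…_of_eq` (G-b): at level `2`, the Kolyvagin class of
  `ι(m Y₁ + T₀)` (`m` odd, `3 T₀ = 0`) is `kummerClassOfPoint Y₁` (Gross (4.4) at the bottom + `2 E(K)` is killed).

Theorems only; no `def`, no `sorry`, no new `Prop`.  Honest label: (F)+(G)+(H) close `stub_layerL1Four` only
MODULO {`hD` #19, `Dt`/`hdeg`, (ES2) = `Nekovar2007.cmPoint_frobeniusCongruence`}; BSD is not proved by any of this.
-/

set_option linter.dupNamespace false
set_option autoImplicit false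

noncomputable section

open scoped Classical Pointwise

namespace Summit.BirchSwinnertonDyer.BirchSwinnertonDyer.Theorems.SylvesterTwoCMFlip

open WeierstrassCurve Field NumberField IsDedekindDomain Finset
open Literature.NumberTheory.EllipticCurves Literature.NumberTheory.GaloisRepresentations
  Literature.NumberTheory.EllipticCurves.HuShuYin2019
  Literature.NumberTheory.EllipticCurves.KolyvaginCocycle
  Summit.BirchSwinnertonDyer.BirchSwinnertonDyer.Theorems.SylvesterTwoCMData

variable {K : Type} [Field K] [NumberField K]

/-- **Kolyvagin's class of a point of the form `m • Y₁ + T₀` (`m` odd, `3 T₀ = 0`, `Y₁, T₀ ∈ E(K)`) at level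
`2` IS the Kummer class `δ Y₁`**: `c(ι(m Y₁ + T₀)) = κ(m Y₁ + T₀)` (Gross (4.4) at the bottom,
`kolyvaginClass_toGeomPoints`) and `m Y₁ + T₀ − Y₁ = 2 • ((m−1)/2 • Y₁ − T₀) ∈ 2 E(K)` (`T₀ = −2 T₀`), killed by
the Kummer map.  For the rows: the bottom `χ_B`-component is `[𝒢 : H] • Y₁ +` (3-torsion), `[𝒢 : H]` odd.
[cite: GrossLMS1991, §4 (4.4) and the Note after Prop. 4.7] [cite: SilvermanAEC2009, VIII.§2 (Kummer sequence)] -/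
theorem kolyvaginClass_toGeomPoints_eq_kummerClassOfPoint (W : WeierstrassCurve ℚ) [(W.baseChange K).IsElliptic]
    {A : AddSubgroup (geomPoints (W.baseChange K))}
    {hdiv : ∀ P : geomPoints (W.baseChange K), ∃ R : geomPoints (W.baseChange K), ((2 : ℕ) : ℤ) • R = P}
    (hA : IsAdmissible (absoluteGaloisGroup K) A ((2 : ℕ) : ℤ))
    (Y₁ T₀ : ((W.baseChange K)).toAffine.Point) (hT₀ : (3 : ℤ) • T₀ = 0) {m : ℤ} (hm : Odd m)
    (hQ : toGeomPoints (W.baseChange K) (m • Y₁ + T₀) ∈ invPoints (absoluteGaloisGroup K) A ((2 : ℕ) : ℤ)) :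
    kolyvaginClass (W.baseChange K) ((2 : ℕ) : ℤ) hdiv hA (toGeomPoints (W.baseChange K) (m • Y₁ + T₀)) hQ =
      kummerClassOfPoint W K Nat.prime_two Y₁ := by
  rw [kolyvaginClass_toGeomPoints]
  obtain ⟨k, hk⟩ := hm
  have hsplit : m • Y₁ + T₀ = Y₁ + ((2 : ℕ) : ℤ) • (k • Y₁ - T₀) := by
    rw [← sub_eq_zero]
    have e : m • Y₁ + T₀ - (Y₁ + ((2 : ℕ) : ℤ) • (k • Y₁ - T₀)) = (3 : ℤ) • T₀ := by
      rw [hk]; push_cast; module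
    rw [e, hT₀]
  rw [hsplit, map_add]
  have hker : ((2 : ℕ) : ℤ) • (k • Y₁ - T₀) ∈ (kummerMapTorsion (W.baseChange K) ((2 : ℕ) : ℤ) hdiv).ker := by
    rw [kummerMapTorsion_ker]
    exact ⟨_, rfl⟩
  rw [AddMonoidHom.mem_ker] at hker
  rw [hker, add_zero]
  rfl

/-- The same class computed at ANY point EQUAL to `ι(m • Y₁ + T₀)` (the rows' bottom `χ_B`-component is such a point,
`bottom_chiComponent_eq_toGeomPoints`; `kolyvaginClass` carries the point as a dependent argument).
[cite: GrossLMS1991, §4 (4.4)] -/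
theorem kolyvaginClass_eq_kummerClassOfPoint_of_eq (W : WeierstrassCurve ℚ) [(W.baseChange K).IsElliptic]
    {A : AddSubgroup (geomPoints (W.baseChange K))}
    {hdiv : ∀ P : geomPoints (W.baseChange K), ∃ R : geomPoints (W.baseChange K), ((2 : ℕ) : ℤ) • R = P}
    (hA : IsAdmissible (absoluteGaloisGroup K) A ((2 : ℕ) : ℤ))
    (Y₁ T₀ : ((W.baseChange K)).toAffine.Point) (hT₀ : (3 : ℤ) • T₀ = 0) {m : ℤ} (hm : Odd m)
    {Q : geomPoints (W.baseChange K)} (hQe : Q = toGeomPoints (W.baseChange K) (m • Y₁ + T₀))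
    (hQ : Q ∈ invPoints (absoluteGaloisGroup K) A ((2 : ℕ) : ℤ)) :
    kolyvaginClass (W.baseChange K) ((2 : ℕ) : ℤ) hdiv hA Q hQ = kummerClassOfPoint W K Nat.prime_two Y₁ := by
  subst hQe
  exact kolyvaginClass_toGeomPoints_eq_kummerClassOfPoint W hA Y₁ T₀ hT₀ hm hQ

omit [NumberField K] in
/-- A cube root of unity of a field containing `K ∋ ω` (`ω² + ω + 1 = 0`) is `1`, `ω` or `ω²`, hence FIXED by every
`K`-automorphism (`μ₃ ⊂ K`). [cite: HuShuYin2019, §1 p. 4 (K = ℚ(√−3) ∋ ω)] -/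
theorem algEquiv_apply_eq_self_of_pow_three_eq_one {L : Type} [Field L] [Algebra K L] {ω : K}
    (hω : ω ^ 2 + ω + 1 = 0) (σ : L ≃ₐ[K] L) {ζ : L} (hζ : ζ ^ 3 = 1) : σ ζ = ζ := by
  have hωL : (algebraMap K L ω) ^ 2 + algebraMap K L ω + 1 = 0 := by
    have := congrArg (algebraMap K L) hω
    simpa using this
  have hprod : (ζ - 1) * (ζ - algebraMap K L ω) * (ζ - (algebraMap K L ω) ^ 2) = 0 := by
    have hω3 : (algebraMap K L ω) ^ 3 = 1 := by
      have : (algebraMap K L ω) ^ 3 - 1 = (algebraMap K L ω - 1) * ((algebraMap K L ω) ^ 2 +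
        algebraMap K L ω + 1) := by ring
      rw [hωL, mul_zero, sub_eq_zero] at this
      exact this
    linear_combination hζ + (ζ - ζ ^ 2) * hωL + (ζ - 1) * hω3
  rcases mul_eq_zero.mp hprod with h | h
  · rcases mul_eq_zero.mp h with h | h
    · rw [sub_eq_zero] at h; rw [h, map_one]
    · rw [sub_eq_zero] at h; rw [h, AlgEquiv.commutes]
  · rw [sub_eq_zero] at h; rw [h, map_pow, AlgEquiv.commutes]

omit [NumberField K] in
/-- **`[Gal(K[9p]/K) : H]` is ODD** for `H` the stabiliser of `∛3, ∛p ∈ K[9p]` (`= Gal(K[9p]/L_{(3p)})`,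
`L_{(3p)} = K(∛3, ∛p)`): `σ ↦ (σ∛3/∛3, σ∛p/∛p)` is a homomorphism to `μ₃ × μ₃` (`μ₃ ⊂ K`) with kernel `H`, so
the index is a power of `3`. [cite: HuShuYin2019, §2 Prop. 2.4 (1) (L_{(3p)} ⊂ H_{9p}, Gal(L/K) ≅ (ℤ/3)²)] -/
theorem odd_card_quotient_stabilizer {L : Type} [Field L] [Algebra K L] {ω : K} (hω : ω ^ 2 + ω + 1 = 0)
    {c₃ cp : L} (hc₃ : c₃ ^ 3 = 3) {p : ℕ} (hp0 : p ≠ 0) (hcp : cp ^ 3 = (p : L)) [CharZero L]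
    (H : Subgroup (L ≃ₐ[K] L)) (hH : ∀ σ, σ ∈ H ↔ σ c₃ = c₃ ∧ σ cp = cp) [Finite (L ≃ₐ[K] L)] :
    Odd (Nat.card ((L ≃ₐ[K] L) ⧸ H)) := by
  have hc₃0 : c₃ ≠ 0 := fun h ↦ by rw [h] at hc₃; norm_num at hc₃
  have hcp0 : cp ≠ 0 := fun h ↦ by
    rw [h, zero_pow three_ne_zero] at hcp; exact hp0 (by exact_mod_cast hcp.symm)
  -- the Kummer characters `σ ↦ σ c / c ∈ μ₃`
  have hchar : ∀ {c : L}, c ≠ 0 → (∃ a : K, c ^ 3 = algebraMap K L a) → ∀ σ τ : L ≃ₐ[K] L,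
      (σ * τ) c / c = σ c / c * (τ c / c) := by
    intro c hc ⟨a, ha⟩ σ τ
    have hζ : (τ c / c) ^ 3 = 1 := by
      rw [div_pow, ← map_pow, ha, AlgEquiv.commutes, div_self]
      rw [← ha]; exact pow_ne_zero 3 hc
    have hfix : σ (τ c / c) = τ c / c := algEquiv_apply_eq_self_of_pow_three_eq_one hω σ hζ
    have e : τ c = τ c / c * c := by rw [div_mul_cancel₀ _ hc]
    rw [AlgEquiv.mul_apply, e, map_mul, hfix]
    field_simp
  have h3K : c₃ ^ 3 = algebraMap K L 3 := by rw [hc₃, map_ofNat]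
  have hpK : cp ^ 3 = algebraMap K L (p : K) := by rw [hcp, map_natCast]
  -- the homomorphism `f : 𝒢 → Lˣ × Lˣ`
  let f : (L ≃ₐ[K] L) →* Lˣ × Lˣ :=
    { toFun := fun σ ↦ (Units.mk0 (σ c₃ / c₃) (div_ne_zero ((map_ne_zero_iff σ σ.injective).mpr hc₃0) hc₃0),
        Units.mk0 (σ cp / cp) (div_ne_zero ((map_ne_zero_iff σ σ.injective).mpr hcp0) hcp0))
      map_one' := by ext <;> simp [hc₃0, hcp0]
      map_mul' := fun σ τ ↦ by
        ext
        · simp only [Units.val_mk0, Prod.fst_mul, Units.val_mul]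
          exact hchar hc₃0 ⟨3, h3K⟩ σ τ
        · simp only [Units.val_mk0, Prod.snd_mul, Units.val_mul]
          exact hchar hcp0 ⟨(p : K), hpK⟩ σ τ }
  have hker : f.ker = H := by
    ext σ
    rw [MonoidHom.mem_ker, hH, Prod.ext_iff]
    simp only [MonoidHom.coe_mk, OneHom.coe_mk, Prod.fst_one, Prod.snd_one, Units.ext_iff, Units.val_mk0,
      Units.val_one, f]
    rw [div_eq_one_iff_eq hc₃0, div_eq_one_iff_eq hcp0]
  -- the range has exponent `3`
  have hf3 : ∀ σ, f σ ^ 3 = 1 := fun σ ↦ by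
    refine Prod.ext (Units.ext ?_) (Units.ext ?_)
    · simp only [Prod.pow_fst, Units.val_pow_eq_pow_val, Units.val_one, Prod.fst_one, MonoidHom.coe_mk,
        OneHom.coe_mk, Units.val_mk0, f]
      rw [div_pow, ← map_pow, h3K, AlgEquiv.commutes, div_self]
      rw [← h3K]; exact pow_ne_zero 3 hc₃0
    · simp only [Prod.pow_snd, Units.val_pow_eq_pow_val, Units.val_one, Prod.snd_one, MonoidHom.coe_mk,
        OneHom.coe_mk, Units.val_mk0, f]
      rw [div_pow, ← map_pow, hpK, AlgEquiv.commutes, div_self]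
      rw [← hpK]; exact pow_ne_zero 3 hcp0
  have hrange : IsPGroup 3 f.range := by
    rintro ⟨x, σ, rfl⟩
    exact ⟨1, Subtype.ext (by rw [pow_one, SubmonoidClass.coe_pow, OneMemClass.coe_one]; exact hf3 σ)⟩
  haveI : Fact (Nat.Prime 3) := ⟨Nat.prime_three⟩
  haveI : Finite f.range := Finite.of_surjective f.rangeRestrict f.rangeRestrict_surjective
  obtain ⟨n, hn⟩ := (IsPGroup.iff_card).mp hrange
  rw [← Subgroup.index_eq_card, ← hker, Subgroup.index_ker, hn]
  exact Odd.pow (by decide)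

/-- **(G-a) THE BOTTOM `χ_B`-COMPONENT IS `[𝒢 : H] • Y₁ + (3-torsion)` in `E_p(K)`.**  Frame `E₉ = (cubeSumCurve 9)_K`,
`ψ_B`, `ρ` (#R-g), an equivariant transport `κ : E₉(K̄) ≃+ W₀(K̄)` (`W₀ : y² + y = x³ − 1`), the embedded level
`K[9p]` (`emb`, `ι_pt`, its fixer `N₀`), `∛3, ∛p ∈ K[9p]`, `H ≤ 𝒢 = Gal(K[9p]/K)` their stabiliser, lifts
`T σ ∈ Γ_K` of the `σ ∈ 𝒢`, and the PRODUCT representatives `t (q, h) = T(q̃) · T(h)` of `Γ_K/N₀`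
(`q̃ = Quotient.out q`).  If `Y₁ ∈ E_p(K)` is HSY's point, read through the frame as
`ι(Y₁) = ψ_B κ⁻¹ ι_pt(Σ_{h ∈ H} h y₁ − T₃)` with `3 T₃ = 0` (#19 `disp₀_of_named`), then
`ψ_B (Σ_i ρ_{t_i}(t_i • κ⁻¹ ι_pt y₁)) = ι([𝒢 : H] • Y₁ + T₀)` for some `T₀ ∈ E_p(K)` with `3 T₀ = 0`:
regroup the sum (`ρ` multiplicative, `ρ_{T h} = 1` as `h` fixes `∛3, ∛p`, hence `v_B`), split
`κ⁻¹ι_pt(Σ_h h y₁) = X + T'` with `ρ_g(g X) = X` (rationality of `Y₁`, `exists_toGeomPoints_eq_cubicTwist_iff`),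
and descend the `Γ_K`-invariant total (`chiComponent_isotypic` at `n = 0`) to `E_p(K)`.
[cite: HuShuYin2019, §4.1 (proof of Thm. 4.4: y₀, the trace, torsion), §2 Prop. 2.4, §3 p. 8]
[cite: GrossLMS1991, §12 (y_χ), §4 (4.1)–(4.2)] -/
theorem bottom_chiComponent_eq_toGeomPoints {ω : K} (hω : ω ^ 2 + ω + 1 = 0)
    (ι : K →+* ℂ) {p : ℕ} (hp0 : p ≠ 0)
    (κ : geomPoints ((cubeSumCurve 9).baseChange K) ≃+
      geomPoints ((⟨0, 0, 1, 0, -1⟩ : WeierstrassCurve ℚ).baseChange K))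
    (hκG : ∀ (g : absoluteGaloisGroup K) (P : geomPoints ((cubeSumCurve 9).baseChange K)),
      κ (g • P) = g • κ P)
    {vB : AlgebraicClosure K} (hvBc : vB ^ 3 = algebraMap ℚ (AlgebraicClosure K) ((p : ℚ) / 9))
    (hvB : vB ≠ 0)
    (hvB3 : ∀ g : absoluteGaloisGroup K,
      ((show AlgebraicClosure K ≃ₐ[K] AlgebraicClosure K from g) vB) ^ 3 = vB ^ 3)
    {ψB : geomPoints ((cubeSumCurve 9).baseChange K) ≃+ geomPoints ((cubeSumCurve (p : ℚ)).baseChange K)}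
    {ρ : absoluteGaloisGroup K →
      geomPoints ((cubeSumCurve 9).baseChange K) ≃+ geomPoints ((cubeSumCurve 9).baseChange K)}
    (hρ : ∀ (g : absoluteGaloisGroup K) {x y : AlgebraicClosure K}
        (h : (((cubeSumCurve 9).baseChange K).baseChange (AlgebraicClosure K)).toAffine.Nonsingular x y),
        ∃ h', ρ g (Affine.Point.some x y h) =
          Affine.Point.some (((show AlgebraicClosure K ≃ₐ[K] AlgebraicClosure K from g) vB / vB) ^ 2 * x)
            y h')
    (hlawB : ∀ (g : absoluteGaloisGroup K) (P : geomPoints ((cubeSumCurve 9).baseChange K)),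
        g • ψB P = ψB (ρ g (g • P)))
    (hρcomm : ∀ (g h : absoluteGaloisGroup K) (P : geomPoints ((cubeSumCurve 9).baseChange K)),
        h • ρ g P = ρ g (h • P))
    -- the embedded level `K[9p]`
    (emb : ringClassField K ι (9 * p) →+* AlgebraicClosure K)
    (ιpt : letI : DecidableEq (ringClassField K ι (9 * p)) := fun a b ↦ Classical.propDecidable (a = b)
      ((⟨0, 0, 1, 0, -1⟩ : WeierstrassCurve ℚ).baseChange (ringClassField K ι (9 * p))).toAffine.Point →+
        geomPoints (((⟨0, 0, 1, 0, -1⟩ : WeierstrassCurve ℚ)).baseChange K))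
    (hιpt : ∀ Q, ιpt Q = Affine.Point.map (W' := (⟨0, 0, 1, 0, -1⟩ : WeierstrassCurve ℚ)) emb.toRatAlgHom Q)
    (N₀ : Subgroup (absoluteGaloisGroup K))
    (hN₀ : ∀ g : absoluteGaloisGroup K, g ∈ N₀ ↔
      ∀ x : ringClassField K ι (9 * p), (show AlgebraicClosure K ≃ₐ[K] AlgebraicClosure K from g) (emb x) = emb x)
    {c₃ cp : ringClassField K ι (9 * p)} (hc₃ : c₃ ^ 3 = 3) (hcp : cp ^ 3 = (p : ringClassField K ι (9 * p)))
    (H : Subgroup (ringClassField K ι (9 * p) ≃ₐ[K] ringClassField K ι (9 * p)))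
    (hH : ∀ σ, σ ∈ H ↔ σ c₃ = c₃ ∧ σ cp = cp)
    [Fintype ((ringClassField K ι (9 * p) ≃ₐ[K] ringClassField K ι (9 * p)) ⧸ H)] [Fintype H]
    (T : (ringClassField K ι (9 * p) ≃ₐ[K] ringClassField K ι (9 * p)) → absoluteGaloisGroup K)
    (hT : ∀ σ (x : ringClassField K ι (9 * p)),
      (show AlgebraicClosure K ≃ₐ[K] AlgebraicClosure K from T σ) (emb x) = emb (σ x))
    (t : ((ringClassField K ι (9 * p) ≃ₐ[K] ringClassField K ι (9 * p)) ⧸ H) × H → absoluteGaloisGroup K)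
    (ht' : ∀ q h, t (q, h) = T (Quotient.out q) * T (h : _))
    (ht : Function.Bijective fun i ↦ (t i : absoluteGaloisGroup K ⧸ N₀))
    -- HSY's points at level `9p` and the rational point `Y₁`
    (y₁ T₃ : ((⟨0, 0, 1, 0, -1⟩ : WeierstrassCurve ℚ).baseChange (ringClassField K ι (9 * p))).toAffine.Point)
    (hT₃ : 3 • T₃ = 0) (Y₁ : ((cubeSumCurve (p : ℚ)).baseChange K).toAffine.Point)
    (hY₁ : toGeomPoints ((cubeSumCurve (p : ℚ)).baseChange K) Y₁ =
      ψB (κ.symm (ιpt ((∑ h : H, pointGalHom (⟨0, 0, 1, 0, -1⟩ : WeierstrassCurve ℚ)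
        (ringClassField K ι (9 * p)) ((h : _ ≃ₐ[K] _).restrictScalars ℚ) y₁) - T₃)))) :
    ∃ T₀ : ((cubeSumCurve (p : ℚ)).baseChange K).toAffine.Point, (3 : ℤ) • T₀ = 0 ∧
      ψB (∑ i, ρ (t i) (t i • κ.symm (ιpt y₁))) =
        toGeomPoints ((cubeSumCurve (p : ℚ)).baseChange K)
          ((Fintype.card ((ringClassField K ι (9 * p) ≃ₐ[K] ringClassField K ι (9 * p)) ⧸ H) : ℤ) • Y₁ + T₀) := by
  -- ### notation-free abbreviations
  have hκs : ∀ (g : absoluteGaloisGroup K) (Q : geomPoints ((⟨0, 0, 1, 0, -1⟩ : WeierstrassCurve ℚ).baseChange K)),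
      κ.symm (g • Q) = g • κ.symm Q := fun g Q ↦
    κ.injective (by rw [hκG, κ.apply_symm_apply, κ.apply_symm_apply])
  -- ### `ι_pt` is additive for the AMBIENT group law on `W₀(K[9p])` (its own is the classical-instance one)
  have hadd : ∀ a b : ((⟨0, 0, 1, 0, -1⟩ : WeierstrassCurve ℚ).baseChange (ringClassField K ι (9 * p))).toAffine.Point,
      ιpt a + ιpt b = ιpt (a + b) := fun a b ↦ by
    rw [hιpt, hιpt, hιpt]
    exact (map_add (Affine.Point.map (W' := (⟨0, 0, 1, 0, -1⟩ : WeierstrassCurve ℚ)) emb.toRatAlgHom) a b).symm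
  have hsum' : ∀ (s : Finset H)
      (f : H → ((⟨0, 0, 1, 0, -1⟩ : WeierstrassCurve ℚ).baseChange (ringClassField K ι (9 * p))).toAffine.Point),
      ∑ x ∈ s, ιpt (f x) = ιpt (∑ x ∈ s, f x) := by
    intro s f
    induction s using Finset.induction_on with
    | empty => rw [Finset.sum_empty, Finset.sum_empty, map_zero]
    | insert _ _ ha ih => rw [Finset.sum_insert ha, Finset.sum_insert ha, ih, hadd]
  have hnsmul : ∀ (n : ℕ)
      (a : ((⟨0, 0, 1, 0, -1⟩ : WeierstrassCurve ℚ).baseChange (ringClassField K ι (9 * p))).toAffine.Point),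
      n • ιpt a = ιpt (n • a) := fun n a ↦ by
    induction n with
    | zero => rw [zero_smul, zero_smul, map_zero]
    | succ n ih => rw [succ_nsmul, succ_nsmul, ih, hadd]
  -- ### `w = ∛p / (∛3)² ∈ emb K[9p]` is a cube root of `p/9`: whoever fixes `emb ∛3, emb ∛p` fixes `v_B`
  have hc₃0 : c₃ ≠ 0 := fun h ↦ by rw [h] at hc₃; norm_num at hc₃
  have hcp0 : cp ≠ 0 := fun h ↦ by
    rw [h, zero_pow three_ne_zero] at hcp; exact hp0 (by exact_mod_cast hcp.symm)
  have hw3 : (emb cp / emb c₃ ^ 2) ^ 3 = vB ^ 3 := by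
    rw [hvBc, div_pow, ← pow_mul, ← map_pow, ← map_pow, hcp, show 2 * 3 = 3 * 2 from rfl, pow_mul, hc₃,
      map_natCast, map_pow, map_ofNat, eq_ratCast]
    push_cast; ring
  have hw0 : emb cp / emb c₃ ^ 2 ≠ 0 :=
    div_ne_zero ((map_ne_zero emb).mpr hcp0) (pow_ne_zero 2 ((map_ne_zero emb).mpr hc₃0))
  have hfixv : ∀ g : absoluteGaloisGroup K,
      (show AlgebraicClosure K ≃ₐ[K] AlgebraicClosure K from g) (emb c₃) = emb c₃ →
      (show AlgebraicClosure K ≃ₐ[K] AlgebraicClosure K from g) (emb cp) = emb cp →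
      (show AlgebraicClosure K ≃ₐ[K] AlgebraicClosure K from g) vB = vB := fun g h3 hp ↦
    JZero.apply_eq_self_of_cubeRoot hω _ hw0 hw3.symm (by rw [map_div₀, map_pow, h3, hp])
  have hTv : ∀ h : H, (show AlgebraicClosure K ≃ₐ[K] AlgebraicClosure K from T (h : _)) vB = vB := fun h ↦
    hfixv _ (by rw [hT, ((hH _).mp h.2).1]) (by rw [hT, ((hH _).mp h.2).2])
  have hNv : ∀ n ∈ N₀, (show AlgebraicClosure K ≃ₐ[K] AlgebraicClosure K from n) vB = vB := fun n hn ↦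
    hfixv _ ((hN₀ n).mp hn c₃) ((hN₀ n).mp hn cp)
  have hρT : ∀ (h : H) (P : geomPoints ((cubeSumCurve 9).baseChange K)), ρ (T (h : _)) P = P := fun h P ↦
    JZero.rho_apply_of_apply_eq hvB hρ (hTv h) P
  -- ### the regrouped sum
  set P₁ := κ.symm (ιpt y₁) with hP₁
  set X := κ.symm (ιpt ((∑ h : H, pointGalHom (⟨0, 0, 1, 0, -1⟩ : WeierstrassCurve ℚ)
        (ringClassField K ι (9 * p)) ((h : _ ≃ₐ[K] _).restrictScalars ℚ) y₁) - T₃)) with hX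
  set T' := κ.symm (ιpt T₃) with hT'
  -- ### `T h • P₁ = κ⁻¹ ι_pt (h y₁)`
  have hTP : ∀ h : H, T (h : _) • P₁ =
      κ.symm (ιpt (pointGalHom (⟨0, 0, 1, 0, -1⟩ : WeierstrassCurve ℚ) (ringClassField K ι (9 * p))
        ((h : _ ≃ₐ[K] _).restrictScalars ℚ) y₁)) := by
    intro h
    have hcomp : ∀ x : ringClassField K ι (9 * p),
        (show AlgebraicClosure K ≃ₐ[K] AlgebraicClosure K from T (h : _)) (emb x) =
          emb ((((h : ringClassField K ι (9 * p) ≃ₐ[K] ringClassField K ι (9 * p)).restrictScalars ℚ :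
            ringClassField K ι (9 * p) ≃ₐ[ℚ] ringClassField K ι (9 * p)) :
              ringClassField K ι (9 * p) →+* ringClassField K ι (9 * p)) x) := fun x ↦ hT (h : _) x
    rw [hP₁, ← hκs, smul_embPoints_eq_of_comp (⟨0, 0, 1, 0, -1⟩ : WeierstrassCurve ℚ) emb ιpt hιpt (T (h : _))
      _ hcomp, map_toRatAlgHom_eq_pointGalHom]
    rfl
  have hsumH : ∑ h : H, T (h : _) • P₁ = X + T' := by
    simp_rw [hTP]
    rw [hX, hT', ← map_add κ.symm, ← map_sum κ.symm, hadd, sub_add_cancel, hsum']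
  have hXinv : ∀ g : absoluteGaloisGroup K, ρ g (g • X) = X :=
    (JZero.exists_toGeomPoints_eq_cubicTwist_iff hlawB X).mp ⟨Y₁, hY₁⟩
  have hregroup : ∑ i, ρ (t i) (t i • P₁) =
      ∑ q : (ringClassField K ι (9 * p) ≃ₐ[K] ringClassField K ι (9 * p)) ⧸ H,
        (X + ρ (T (Quotient.out q)) (T (Quotient.out q) • T')) := by
    rw [Fintype.sum_prod_type]
    refine Finset.sum_congr rfl fun q _ ↦ ?_
    have e : ∀ h : H, ρ (t (q, h)) (t (q, h) • P₁) =
        ρ (T (Quotient.out q)) (T (Quotient.out q) • (T (h : _) • P₁)) := by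
      intro h
      rw [ht', JZero.rho_mul_apply_of_omega hω hvB hvB3 hρ, mul_smul, hρT]
    simp_rw [e]
    rw [← map_sum, ← Finset.smul_sum, hsumH, smul_add, map_add, hXinv]
  have hsum : ∑ i, ρ (t i) (t i • P₁) =
      (Fintype.card ((ringClassField K ι (9 * p) ≃ₐ[K] ringClassField K ι (9 * p)) ⧸ H) : ℤ) • X +
        ∑ q : (ringClassField K ι (9 * p) ≃ₐ[K] ringClassField K ι (9 * p)) ⧸ H,
          ρ (T (Quotient.out q)) (T (Quotient.out q) • T') := by
    rw [hregroup, Finset.sum_add_distrib, Finset.sum_const, Finset.card_univ, natCast_zsmul]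
  -- ### the total is `(Γ_K, χ_B)`-invariant, hence `ψ_B` of it is `Γ_K`-fixed and descends to `E_p(K)`
  have hP₁N : ∀ n ∈ N₀, n • P₁ = P₁ := fun n hn ↦ by
    rw [hP₁, ← hκs, smul_embPoints_eq_self (⟨0, 0, 1, 0, -1⟩ : WeierstrassCurve ℚ) emb ιpt hιpt n ((hN₀ n).mp hn)]
  have hinv : ∀ g : absoluteGaloisGroup K, ρ g (g • ∑ i, ρ (t i) (t i • P₁)) = ∑ i, ρ (t i) (t i • P₁) := by
    intro g
    obtain ⟨R, -, hR⟩ := chiComponent_isotypic (G := absoluteGaloisGroup K)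
      (M := geomPoints ((cubeSumCurve 9).baseChange K)) (fun g ↦ (ρ g).toAddMonoidHom)
      (fun g g' m ↦ JZero.rho_mul_apply_of_omega hω hvB hvB3 hρ g g' m) (fun g g' m ↦ hρcomm g g' m)
      (N := (N₀ : Set (absoluteGaloisGroup K))) (fun n hn m ↦ JZero.rho_apply_of_apply_eq hvB hρ (hNv n hn) m)
      (A := ⊤) (fun _ _ _ ↦ trivial) (fun _ _ _ ↦ trivial) (n := 0) t
      (exists_perm_of_bijective_quotient N₀ t ht) (P := P₁)
      (fun n hn ↦ ⟨0, trivial, by rw [hP₁N n hn, sub_self, zero_smul]⟩) g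
    rw [zero_smul] at hR
    exact (sub_eq_zero.mp hR.symm)
  have hfix : ∀ g : absoluteGaloisGroup K, g • ψB (∑ i, ρ (t i) (t i • P₁)) = ψB (∑ i, ρ (t i) (t i • P₁)) :=
    fun g ↦ by rw [hlawB, hinv]
  obtain ⟨Z, hZ⟩ := exists_toGeomPoints_eq_of_forall_smul_eq ((cubeSumCurve (p : ℚ)).baseChange K) hfix
  -- ### the torsion part
  refine ⟨Z - (Fintype.card ((ringClassField K ι (9 * p) ≃ₐ[K] ringClassField K ι (9 * p)) ⧸ H) : ℤ) • Y₁,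
    ?_, by rw [add_sub_cancel, hZ]⟩
  have h3ι : (3 : ℕ) • ιpt T₃ = 0 := by rw [hnsmul, hT₃, map_zero]
  have h3T' : (3 : ℤ) • T' = 0 := by
    rw [hT', ← map_zsmul κ.symm, show (3 : ℤ) = ((3 : ℕ) : ℤ) from rfl, natCast_zsmul, h3ι, map_zero]
  have htors : (3 : ℤ) • ∑ q : (ringClassField K ι (9 * p) ≃ₐ[K] ringClassField K ι (9 * p)) ⧸ H,
      ρ (T (Quotient.out q)) (T (Quotient.out q) • T') = 0 := by
    rw [Finset.smul_sum]
    refine Finset.sum_eq_zero fun q _ ↦ ?_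
    rw [← map_zsmul, smul_comm, h3T', smul_zero, map_zero]
  apply toGeomPoints_injective ((cubeSumCurve (p : ℚ)).baseChange K)
  rw [map_zsmul, map_sub, map_zsmul, hZ, hY₁, map_zero, ← map_zsmul ψB, ← map_sub ψB, hsum,
    add_sub_cancel_left, ← map_zsmul ψB, htors, map_zero]

end Summit.BirchSwinnertonDyer.BirchSwinnertonDyer.Theorems.SylvesterTwoCMFlip

end
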